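import Mathlib
import HarnessLib
import Summits.ValiantsHypothesis.ValiantsHypothesis.Theses.ValuativeGCT
import Summits.ValiantsHypothesis.ValiantsHypothesis.Theorems.ValuativeGCTValuativeFlipTailSuffices
import Summits.ValiantsHypothesis.ValiantsHypothesis.Theorems.ValuativeGCTValuativeFlipKroneckerCensus
import Summits.ValiantsHypothesis.ValiantsHypothesis.Theorems.ValuativeGCTValuativeFlipRayStabilityKronecker
import Summits.ValiantsHypothesis.ValiantsHypothesis.Theorems.ValuativeGCTValuativeFlipRayFromBottom
import Summits.ValiantsHypothesis.ValiantsHypothesis.Theorems.ValuativeGCTValuativeFlipPaddingTransfer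
import Summits.ValiantsHypothesis.ValiantsHypothesis.Theorems.ValuativeGCTTailFlipBoundaryPaddingInvariance

/-!
# Skeleton — line `boundary-ray-collapse` for crux `ValuativeGCT.TailFlip` (stmt-ValiantsHypothesis-15687)

Crux-plan (planner-cruxplan-stmt-ValiantsHypothesis-15687-boundary-ray-collaps-0, 2026-08-16) of the
round-2 crux idea `Cruxes/TailFlip/Ideas/boundary-ray-collapse.md` (ideator 4), sharpened by the triage
panel TRIAGE-r2-1/2/3.  Line card: `Cruxes/TailFlip/Lines/boundary-ray-collapse.md`.

Letters: inner (permanent) size `n`, a PADDED base level `m₀` (`n < m₀`; the card's choice is `m₀ = 2n`),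
padding `j`, level `m = m₀ + j`, degree `δ`, top variable `X_top = X (topMatIdx m₀)` (the LAST letter,
which carries `-λ₁` in the dual weight `λ* = partitionWeightLex m₀ λ`).  A KADISH–LANDSBERG BOUNDARY
shape for `(n, m₀)` is `λ ⊢ m₀·δ` with first row EXACTLY `λ₁ = δ(m₀ - n)` (`lam.parts.sup = δ * (m₀ - n)`),
so `λ = (δ(m₀-n)) ∪ λ̄`, `λ̄ ⊢ nδ`; its row-lift `λ♯(m₀+j) = rowLift λ j = (δ(m₀+j-n)) ∪ λ̄` is the boundary
shape of `(n, m₀ + j)`.  `P_{n,m}(λ) := mult_{λ*} ℂ[Δ_m(X₀₀^{m-n} per_n)] = orbitMultiplicity ℂ (paddedPerFormLex ℂ n m) m λ*`;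
`g(λ, m×δ, m×δ) = kroneckerCoeff ℂ λ □ □`; window top `M_c(n) = 2^((log₂ n + c)^c)`.

## The line (lead a1 reshape, 2026-08-16: THREE registered stubs; `TailFlip_of` sorry-free over them)

Lead's reshape of the planner's skeleton (sha e616a748): the planner's typed proof plan for
`stub_boundaryPaddingInvariance` (`def BoundaryTwistScalar`, `def ScalarTwistInheritance`,
`boundaryPaddingInvariance_of_plan`) is promoted to two REGISTERED stubs `stub_boundaryTwistScalar` (L1)
and `stub_scalarTwistInheritance` (engine), and `boundaryPaddingInvariance` is now their sorry-free
consequence (same statement as the former `stub_boundaryPaddingInvariance`); `stub_topBoundaryFlip` is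
unchanged.  Stubs: `stub_boundaryTwistScalar`, `stub_scalarTwistInheritance`, `stub_topBoundaryFlip`.
Wave 1 (2026-08-16): `stub_boundaryTwistScalar` LANDED (p130976,
`Theorems/ValuativeGCTTailFlipStubBoundaryTwistScalar.lean`) and `stub_scalarTwistInheritance` LANDED (p130829,
`Theorems/ValuativeGCTTailFlipStubScalarTwistInheritance.lean`), and their composition — the lever
`boundaryPaddingInvariance` (registered sub-goal, = the planner's former `stub_boundaryPaddingInvariance`) —
LANDED (p131486, `Theorems/ValuativeGCTTailFlipBoundaryPaddingInvariance.lean`, with the monotone form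
`boundaryPaddingInvariance_mono`); the skeleton imports it, so the only remaining sorry is `stub_topBoundaryFlip`.
Constraints on its witnesses (large body `nδ > M`, `ℓ(λ) ≥ 4`, `1 + n(n+1)^ℓ(λ) > M`) are theorems:
`Theorems/ValuativeGCTTailFlipTopBoundaryFlipConstraints.lean` (`topBoundaryFlip_witness_constraints`).

* `stub_boundaryPaddingInvariance` (the LEVER made a theorem; M, provable now): along the boundary ray of
  `(n, m₀)` the padded-permanent multiplicity never drops below its value at the PADDED base, at EVERY
  padding: `P_{n,m₀}(λ) ≤ P_{n,m₀+j}(λ♯(m₀+j))` for `λ₁ = δ(m₀ - n)`.  Typed proof plan (defs, kernel-checked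
  to imply the stub: `boundaryPaddingInvariance_of_plan`):
  - `BoundaryTwistScalar` (L1, the lever proper, S/M): at boundary weight every highest-weight vector `F`
    reads a column-normalised point `A · X₀₀^{m₀-n} per_n = X_top^{m₀-n} · per_n(A x)` only through the
    minimal top layer `e_top = m₀ - n` (isobaric weight count `Σ_i e_i(top) = λ₁ = δ(m₀-n)` against
    `e_i(top) ≥ m₀ - n`), so BIP's padding twist `Δ_j : x^e ↦ (e_top+j)!/e_top! · x^e` acts on `F(A · pp)`
    as the SCALAR `((m₀-n+j).descFactorial j)^δ` — at EVERY column-normalised point;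
  - `ScalarTwistInheritance` (the engine, S, any shape): a scalar nonzero twist turns the full UNtwisted
    column-normalised certificate of size `P_{n,m₀}(λ)` that exists at the padded level
    (`exists_evalCertificate_col`, or `orbitMultiplicity_add_finrank_ker_bottom` + the alternant lemma; no
    `λ₂` hypothesis) into a nonsingular TWISTED one (`Matrix.det_smul`), which `twistedInheritance_padded`
    lifts.  (Padded-base steps are FALSE for general shapes — `padding_step_monotonicity_fails`; the
    boundary weight is exactly what repairs them.)
* `stub_topBoundaryFlip` (the RESIDUAL = the card's Transfer `C⁺`, OPEN, crux-strength; triage sharpening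
  "c ≥ 2 / guard the top" built in as the hypothesis `n^k ≤ M_c(n)`, and the base level freed from `2n` to
  any `n < m₀ ≤ n^k`, which only weakens it): for some fixed `k ≥ 2`, every `c` and all large `n` with
  `n^k ≤ M_c(n)`, ONE boundary datum `(m₀, δ, λ)` has its rectangular Kronecker coefficient at the window
  TOP below the padded-permanent multiplicity at the BASE: `g(λ♯M, M×δ, M×δ) < P_{n,m₀}(λ)`, `M = M_c(n)`.
  One inequality per `(n, c)`; no `∀ m`, no centre (`U = ⊥`).

Composition (`TailFlip_of`): at a position `(n, m)` with `n^k ≤ m ≤ M_c(n)` write `m = m₀ + j`; with the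
no-cut centre `U = ⊥, r = 0` and the shape `λ♯(m₀+j)`:
`dim T_⊥ ≤ dim T₀ ≤ g(λ♯(m₀+j), (m₀+j)×δ, (m₀+j)×δ)` (`stub_truncT0_le_kronecker`, BLMW Prop. 5.2.1)
`≤ g(λ♯M, M×δ, M×δ)` (`kronecker_ray_mono`, Manivel) `< P_{n,m₀}(λ)` (`stub_topBoundaryFlip`)
`≤ P_{n,m₀+j}(λ♯(m₀+j))` (`stub_boundaryPaddingInvariance`); positions below `n^k` carry no logical weight
(`valuativeFlip_iff_polyPadded`, landed re-windowing by inner monotonicity), so this is `ValuativeFlip`,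
and `TailFlip` by `tailFlip_iff_valuativeFlip`.  Every arrow outside the two stubs is a landed theorem.

Disproof honoured (`Cruxes/TailFlip/Disproof.lean`, cdisprove cycle 1): T1 (`certificate_le_finrank_of_endDet`)
— no level-`m` certificates at all; the only certificates live at the base `m₀ ≤ n^k` (per side) and
nothing is certified on the det side (it is majorised by `g`); T2 (`not_tailFlipWithoutTop`,
`not_tailFlipUniform`) — the window top `M_c(n)` is explicit in `stub_topBoundaryFlip`, whose threshold
`n₀` depends on `c`; the typed `c = 0` artefact of the card (`¬ TopBoundaryFlip` as typed, TRIAGE-r2-1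
W.lean) is removed by the guard `n^k ≤ M_c(n)`; T3 (`not_tailFlipLen`) — the witness length `ℓ(λ) ≤ n²+1`
is free to grow with `(n, c)` (a true instance needs `1 + n(n+1)^ℓ(λ) > M_c(n)`); T4 — the residual implies
`ValuativeFlip`, hence `DcPerSuperpolynomial ℂ` (accepted: it is a strengthening by design); T5 — at
`M ≥ n^25` both `K_M` and `g_M` are positive, so the residual asks `P_{n,m₀}(λ) ≥ 2`, a genuine multiplicity
statement; parent F4/F6 — centre `U = ⊥` with `r = 0` is admissible.  Landed Negative lemmas
(`Theorems/TailFlip/Negative/*`): no stub is an instance they refute (the residual keeps `∃ n₀(c)`, the top,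
and unbounded length).  Negatives index (4 entries: Ulrich padding, elusive candidate, Grenet rigidity ×2):
untouched.

Sorries live only in `stub_*`.
[Cruxes/TailFlip/Ideas/boundary-ray-collapse.md; TRIAGE-r2-1 §boundary-ray-collapse (pass, sharpen c ≥ 2),
TRIAGE-r2-2/3 (fail: reach — the row-lift collapse `TopRowLiftKroneckerFlip → TailFlip` is free over
`perAnchorInheritance_every`; recorded in the line card); Kadish–Landsberg arXiv:1204.4693 §2; BLMW
arXiv:0907.2850 §5.2 Prop. 5.2.1, §6.4 Problem 6.10; Manivel arXiv:0907.3351 Thm 1; Ikenmeyer–Panova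
arXiv:1512.03798 Thm 2.1, Prop. 2.6(b), Cor. of Prop. 15; BIP arXiv:1604.06431 Lemma 5.2–5.3, Thm 5.4;
Bläser–Ikenmeyer 2025 (doi:10.4086/toc.gs.2025.010) §12.4]
-/

set_option linter.dupNamespace false

namespace Summit.ValiantsHypothesis.ValiantsHypothesis.Cruxes.TailFlip.BoundaryRayCollapse

open MvPolynomial
open scoped BigOperators Matrix
open Literature.NumberTheory.DiophantineGeometry
open Literature.Computability.AlgebraicComplexity
open Literature.Computability.Complexity
open Summit.ValiantsHypothesis.ValiantsHypothesis.Theses.ValuativeGCT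
open Summit.ValiantsHypothesis.ValiantsHypothesis.Theorems.ValuativeFlip

noncomputable section

/-! ## Stub 2 — the residual (the card's Transfer `C⁺`): ONE window-top inequality per `(n, c)` -/

/-- **stub_topBoundaryFlip** (OPEN — the residual of the line, crux-strength: it implies `TailFlip`
by `TailFlip_of`, hence `ValuativeFlip` and `DcPerSuperpolynomial ℂ`).  For some fixed `k ≥ 2`: for
every window exponent `c` and all large `n` whose window reaches the polynomial padding `n^k`
(`n^k ≤ M`, `M = 2^((log₂ n + c)^c)` — this guard is exactly what the composition can use, and it
removes the `c = 0` artefact of the card's typed `TopBoundaryFlip`), there are a padded BASE level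
`m₀` with `n < m₀ ≤ n^k` (the card: `m₀ = 2n`), a degree `δ` and a Kadish–Landsberg BOUNDARY shape
`λ ⊢ m₀·δ` (first row exactly `δ(m₀ - n)`, at most `n² + 1` parts) such that the rectangular Kronecker
coefficient of its row-lift to the window TOP is smaller than the padded-permanent multiplicity at the
BASE: `g(λ♯M, M×δ, M×δ) < mult_{λ*} ℂ[Δ_{m₀}(X₀₀^{m₀-n} per_n)]`.
Constraints any witness meets (recorded, not assumed): body `nδ > M` (else Manivel/IP17 stability
`kroneckerCoeff_rowLift_eq` + `g ≥ a ≥ P` kills it: `noSmallBodyFlip`), so `δ > M/n`; `ℓ(λ) > log_{n+1}(M/n)`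
(`Negative.not_tailFlipLen`); `g(λ♯M) ≥ 1` for `M ≥ n^25` (IP17 Thm 1.5), so `P ≥ 2`; the witnesses must be
Kronecker-ATYPICAL boundary shapes (card B2: typical ones lose by `2^{Θ(M log n)}` vs `δ^{O(n⁴)}`).
Disprover target that kills it: "early-rising rectangular Kronecker rays",
`g((δ(m-n)) ∪ λ̄, m×δ, m×δ) ≥ P_{n,m₀}((δ(m₀-n)) ∪ λ̄)` from some `m ≤ poly(n)` on.
Why easier than the crux (card, Transfer (i)–(iv)): the `∀ m` over the super-polynomial tail is gone
EXACTLY; the per side is a finite certificate rank at a polynomial level `m₀ ≤ n^k` inside the LMR range;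
the det side is one classical number with Manivel's `SL_δ`-model.  Honest label (TRIAGE-r2-2/3): with
`U = ⊥` this is `GCTMult.GctKroneckerFlip` (stmt-0888) restricted to boundary shapes at the top cell, and
the analogous collapse on ROW-LIFT rays (`g(μ♯M) < P_n(μ)`) already implies `TailFlip` over landed lemmas.
[card §Transfer; TRIAGE-r2-1 sharpen; Manivel arXiv:0907.3351 Thm 1; IP17 arXiv:1512.03798 Thm 2.1;
Bläser–Ikenmeyer 2025 §12.4] -/
theorem stub_topBoundaryFlip :
    ∃ k : ℕ, 2 ≤ k ∧ ∀ c : ℕ, ∃ n₀ : ℕ, ∀ n ≥ n₀,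
      n ^ k ≤ 2 ^ ((Nat.log 2 n + c) ^ c) →
      ∃ (m₀ : ℕ) (_ : NeZero m₀) (δ : ℕ) (lam : Nat.Partition (m₀ * δ)),
        n < m₀ ∧ m₀ ≤ n ^ k ∧ lam.parts.card ≤ n * n + 1 ∧ lam.parts.sup = δ * (m₀ - n) ∧
        kroneckerCoeff ℂ (rowLift lam (2 ^ ((Nat.log 2 n + c) ^ c) - m₀))
            (Nat.Partition.rectangle (m₀ + (2 ^ ((Nat.log 2 n + c) ^ c) - m₀)) δ)
            (Nat.Partition.rectangle (m₀ + (2 ^ ((Nat.log 2 n + c) ^ c) - m₀)) δ) <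
          orbitMultiplicity ℂ (paddedPerFormLex ℂ n m₀) m₀ (partitionWeightLex m₀ lam) := by
  sorry

/-! ## Glue (sorry-free over the stubs; every other ingredient is a landed theorem) -/

/-- Monotonicity of `finrank` below a homogeneous component (copy of the landed
`Theorems.ValuativeFlip.finrank_mono_of_le_homogeneous`, `…OfKroneckerFlip`, kept local to avoid importing
route GCTMult's thesis file into this workfile). [folklore] -/
theorem brc_finrank_mono_of_le_homogeneous {m D : ℕ} {S T : Submodule ℂ (MvPolynomial (MatIdx m × MatIdx m) ℂ)}
    (hT : T ≤ MvPolynomial.homogeneousSubmodule (MatIdx m × MatIdx m) ℂ D) (hST : S ≤ T) :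
    Module.finrank ℂ ↥S ≤ Module.finrank ℂ ↥T :=
  haveI : Module.Finite ℂ ↥(MvPolynomial.homogeneousSubmodule (MatIdx m × MatIdx m) ℂ D) :=
    Module.Finite.iff_fg.mpr (MvPolynomial.homogeneousSubmodule_fg _ _ _)
  haveI : Module.Finite ℂ ↥T := Submodule.finiteDimensional_of_le hT
  Submodule.finrank_mono hST

/-- **The whole window flips above the base** (stubs 1–2 + landed arrows): `ValuativeGCT.ValuativeFlip`.
By `valuativeFlip_iff_polyPadded k` only positions `n^k ≤ m ≤ M_c(n)` matter; there `m = m₀ + j` lies on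
the boundary ray above the base and
`dim T_⊥(λ♯(m₀+j)) ≤ dim T₀ ≤ g(λ♯(m₀+j)) ≤ g(λ♯M) < P_{n,m₀}(λ) ≤ P_{n,m₀+j}(λ♯(m₀+j))`
(`stub_truncT0_le_kronecker`, `kronecker_ray_mono`, `stub_topBoundaryFlip`, landed `Theorems.TailFlip.boundaryPaddingInvariance`),
with the no-cut centre `U = ⊥`, `r = 0`. [this file] -/
theorem valuativeFlip_of_stubs : ValuativeFlip := by
  obtain ⟨k, hk, hC⟩ := stub_topBoundaryFlip
  refine (valuativeFlip_iff_polyPadded k (by omega)).mpr fun c => ?_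
  obtain ⟨n₀, hn₀⟩ := hC c
  refine ⟨n₀, fun n hn m _ hkm hm => ?_⟩
  obtain ⟨m₀, hm₀, δ, lam, hnm₀, hm₀k, hcard, hsup, hlt⟩ := hn₀ n hn (hkm.trans hm)
  haveI := hm₀
  -- the position lies on the ray above the base: `m = m₀ + j`
  obtain ⟨j, rfl⟩ : ∃ j, m = m₀ + j := ⟨m - m₀, by omega⟩
  set M := 2 ^ ((Nat.log 2 n + c) ^ c) with hM
  have hjM : j ≤ M - m₀ := by omega
  have hlam : lam.parts.card ≤ m₀ * m₀ := hcard.trans (by nlinarith)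
  have hcard' : (rowLift lam j).parts.card ≤ (m₀ + j) * (m₀ + j) :=
    (card_parts_rowLift_le lam j).trans (max_le (hlam.trans (Nat.mul_le_mul (Nat.le_add_right m₀ j)
      (Nat.le_add_right m₀ j))) (Nat.one_le_iff_ne_zero.2 (mul_ne_zero (NeZero.ne (m₀ + j)) (NeZero.ne (m₀ + j)))))
  refine ⟨⊥, 0, δ, rowLift lam j, ?_, hcard', ?_⟩
  · intro u hu
    rw [Submodule.mem_bot] at hu
    subst hu
    have h0 : (Matrix.of fun a b : Fin (m₀ + j) => (0 : MatIdx (m₀ + j) → ℂ) (toLex (a, b))) = 0 := by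
      ext a b
      simp
    rw [h0, Matrix.rank_zero]
  · -- det side: no cut ≤ untruncated census ≤ Kronecker at this level ≤ Kronecker at the top
    have hT0 := stub_truncT0_le_kronecker (m₀ + j) δ (rowLift lam j) hcard'
    have hray := kronecker_ray_mono m₀ δ lam hjM
    -- per side: frozen at the base along the boundary ray
    have hper := Theorems.TailFlip.boundaryPaddingInvariance n m₀ j δ hnm₀ lam hlam hsup
    refine lt_of_le_of_lt ((brc_finrank_mono_of_le_homogeneous (D := (m₀ + j) * δ) ?_ ?_).trans (hT0.trans hray))
      (lt_of_lt_of_le hlt hper)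
    · exact inf_le_left.trans inf_le_left
    · exact inf_le_inf (inf_le_inf inf_le_left le_rfl) le_rfl

/-- **The crux from the stubs**: `ValuativeGCT.TailFlip` BY NAME (the tail child is the restriction of
`ValuativeFlip`, `tailFlip_iff_valuativeFlip`).  Sorry-free over the two stubs. [this file] -/
theorem TailFlip_of :
    Summit.ValiantsHypothesis.ValiantsHypothesis.Theses.ValuativeGCT.TailFlip :=
  tailFlip_iff_valuativeFlip.mpr valuativeFlip_of_stubs

end

end Summit.ValiantsHypothesis.ValiantsHypothesis.Cruxes.TailFlip.BoundaryRayCollapse
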